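import Summits.NavierStokesRegularity.NavierStokesRegularity.Theses.TypeIQuarterGate
import Summits.NavierStokesRegularity.NavierStokesRegularity.Theorems.TypeIQuarterGateQuarterLawTypeIStubCountQuarterLaw
import Summits.NavierStokesRegularity.NavierStokesRegularity.Theorems.StretchingWellBindingEnstrophyQuarterLawToEnergyHalfHolder
import Summits.NavierStokesRegularity.NavierStokesRegularity.Theorems.HalfHolderEnergyHolderBridge
import HarnessLib

/-!
# `TypeIQuarterGate.QuarterLawTypeI` (crux stmt-NavierStokesRegularity-23726) is EQUIVALENT to the
# scale-uniform ε-concentration count `UniformConcentrationCountTypeI` (crux stmt-23970)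

Helper file (`--supports stmt-NavierStokesRegularity-23726`). The route text records "S1′ ⇔ K1 modulo
provable glue (K1 ⇒ S1′: `N ≤ 2K/η`; S1′ ⇒ K1: `CountQuarterLaw`)". Both glues are now tree theorems:

* `count_of_quarterLaw` — K1 ⇒ S1′ for ONE solution: if `∫ ‖curl u(t)‖² ≤ K/√(T−t)` on `[0,T)` then at
  every scale `0 < r ≤ √T` a `2r`-separated family of centres whose vertex-`T` cylinders carry
  `∫_{T−r²}^{T} ∫_{B_r(x)} |∇u|_F² ≥ η r` has at most `⌊2K⁺/η⌋` members (disjoint balls, superadditivity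
  of the lower integral, the whole-space div–curl bound
  `lintegral_frobeniusNormSq_fderiv_le_lintegral_sq_norm_curl`, and the window law
  `∫_{T−r²}^{T} ∫ |curl u|² ≤ 2K⁺ r` from `WindowConverters.lintegral_Ioo_le_sqrt_of_slice_le`).
* `quarterLawTypeI_iff_uniformConcentrationCountTypeI` — `QuarterLawTypeI ↔ UniformConcentrationCountTypeI`
  (⇐ is the landed by-name stub `CountQuarterLaw.stub_countQuarterLaw`).

HONEST FRAMING: an equivalence between two OPEN statements about hypothetical Type-I blow-ups; neither is
asserted, and nothing about Navier–Stokes regularity or blow-up is claimed. [folklore]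
-/

-- the problem directory repeats the summit name (`NavierStokesRegularity/NavierStokesRegularity`)
set_option linter.dupNamespace false

noncomputable section

namespace Summit.NavierStokesRegularity.NavierStokesRegularity.Theorems

namespace CountQuarterLaw

open Set MeasureTheory Function Metric Filter Topology
open scoped ENNReal NNReal
open Literature.Analysis.FluidPDE

/-- Superadditivity of the lower Lebesgue integral over a finite sum (no measurability). [folklore] -/
theorem sum_lintegral_le {α β : Type*} [MeasurableSpace α] (μ : Measure α) (s : Finset β)
    (f : β → α → ℝ≥0∞) : ∑ b ∈ s, ∫⁻ a, f b a ∂μ ≤ ∫⁻ a, ∑ b ∈ s, f b a ∂μ := by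
  classical
  induction s using Finset.induction_on with
  | empty => simp
  | insert b s hb ih =>
    rw [Finset.sum_insert hb]
    calc ∫⁻ a, f b a ∂μ + ∑ x ∈ s, ∫⁻ a, f x a ∂μ
        ≤ ∫⁻ a, f b a ∂μ + ∫⁻ a, ∑ x ∈ s, f x a ∂μ := add_le_add le_rfl ih
      _ ≤ ∫⁻ a, (f b a + ∑ x ∈ s, f x a) ∂μ := le_lintegral_add _ _
      _ = ∫⁻ a, ∑ x ∈ insert b s, f x a ∂μ := by
          refine lintegral_congr fun a => ?_
          rw [Finset.sum_insert hb]

/-- **K1 ⇒ S1′ for one solution: the quarter law bounds the concentration count by `2K⁺/η`.**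
Classical solution on `[0,T)` (`ν > 0`), Leray–Hopf on `[0,T]`, `∫ ‖curl u(t)‖² ≤ K/√(T−t)` on `[0,T)`:
for `η > 0`, `0 < r ≤ √T` and a `2r`-separated finite family `σ` of centres whose vertex-`T` cylinders
`(T−r², T) × B_r(x)` carry `∫∫ |∇u|_F² ≥ η r`, `#σ ≤ ⌊2K⁺/η⌋`. [folklore] -/
theorem count_of_quarterLaw {ν T : ℝ} (hν : 0 < ν) (hT : 0 < T)
    {u : ℝ → EuclideanSpace ℝ (Fin 3) → EuclideanSpace ℝ (Fin 3)}
    {p : ℝ → EuclideanSpace ℝ (Fin 3) → ℝ}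
    (hsol : IsClassicalNSSolutionOn (Ico 0 T) ν 0 u p) (hLH : IsLerayHopfOn T ν 0 (u 0) u)
    {K : ℝ} (hq : ∀ t ∈ Ico 0 T, ∫⁻ x, ‖curl (u t) x‖ₑ ^ 2 ≤ ENNReal.ofReal (K / Real.sqrt (T - t)))
    {η : ℝ} (hη : 0 < η) {r : ℝ} (hr : 0 < r) (hrT : r ≤ Real.sqrt T)
    (σ : Finset (EuclideanSpace ℝ (Fin 3)))
    (hsep : ∀ x ∈ σ, ∀ x' ∈ σ, x ≠ x' → 2 * r ≤ ‖x - x'‖)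
    (hconc : ∀ x ∈ σ, ENNReal.ofReal (η * r) ≤ ∫⁻ s in Ioo (T - r ^ 2) T, ∫⁻ y in ball x r,
      ENNReal.ofReal (frobeniusNormSq (fderiv ℝ (u s) y))) :
    σ.card ≤ ⌊2 * max K 0 / η⌋₊ := by
  classical
  -- the window law with the non-negative constant `2 K⁺`
  set K' : ℝ := max K 0 with hK'
  have hK'0 : 0 ≤ K' := le_max_right _ _
  have hq' : ∀ t ∈ Ico 0 T, ∫⁻ x, ‖curl (u t) x‖ₑ ^ 2 ≤ ENNReal.ofReal (K' / Real.sqrt (T - t)) :=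
    fun t ht => (hq t ht).trans (ENNReal.ofReal_le_ofReal
      (div_le_div_of_nonneg_right (le_max_left _ _) (Real.sqrt_nonneg _)))
  have hr2T : r ^ 2 ≤ T := by
    have h := pow_le_pow_left₀ hr.le hrT 2
    rwa [Real.sq_sqrt hT.le] at h
  have ha : 0 ≤ T - r ^ 2 := sub_nonneg.2 hr2T
  have hab : T - r ^ 2 ≤ T := by nlinarith
  have hwin : ∫⁻ t in Ioo (T - r ^ 2) T, ∫⁻ x, ‖curl (u t) x‖ₑ ^ 2 ≤
      ENNReal.ofReal (2 * K' * Real.sqrt (T - (T - r ^ 2))) :=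
    WindowConverters.lintegral_Ioo_le_sqrt_of_slice_le (Z := fun t => ∫⁻ x, ‖curl (u t) x‖ₑ ^ 2)
      hK'0 hq' ha hab le_rfl
  have hsq : Real.sqrt (T - (T - r ^ 2)) = r := by rw [sub_sub_cancel, Real.sqrt_sq hr.le]
  rw [hsq] at hwin
  -- the balls `B_r(x)`, `x ∈ σ`, are pairwise disjoint
  have hdisj : Set.PairwiseDisjoint (↑σ : Set (EuclideanSpace ℝ (Fin 3))) (fun x => ball x r) := by
    intro x hx x' hx' hne
    have h2 : 2 * r ≤ dist x x' := by rw [dist_eq_norm]; exact hsep x hx x' hx' hne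
    exact ball_disjoint_ball (by linarith)
  -- the physical dissipation density
  set F : ℝ → EuclideanSpace ℝ (Fin 3) → ℝ≥0∞ := fun s y =>
    ENNReal.ofReal (frobeniusNormSq (fderiv ℝ (u s) y)) with hF
  -- lower bound
  have hlow : (σ.card : ℝ≥0∞) * ENNReal.ofReal (η * r) ≤
      ∑ x ∈ σ, ∫⁻ s in Ioo (T - r ^ 2) T, ∫⁻ y in ball x r, F s y := by
    rw [← nsmul_eq_mul, ← Finset.sum_const]
    exact Finset.sum_le_sum fun x hx => hconc x hx
  -- upper bound: superadditivity, disjoint union, whole space, div–curl, window law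
  have hup : ∑ x ∈ σ, ∫⁻ s in Ioo (T - r ^ 2) T, ∫⁻ y in ball x r, F s y ≤
      ENNReal.ofReal (2 * K' * r) := by
    refine (sum_lintegral_le _ σ _).trans ?_
    have h1 : ∫⁻ s in Ioo (T - r ^ 2) T, ∑ x ∈ σ, ∫⁻ y in ball x r, F s y ≤
        ∫⁻ s in Ioo (T - r ^ 2) T, ∫⁻ y, F s y := by
      refine lintegral_mono fun s => ?_
      rw [← lintegral_biUnion_finset hdisj (fun x _ => measurableSet_ball)]
      exact setLIntegral_le_lintegral _ _
    refine h1.trans ((setLIntegral_mono_ae' measurableSet_Ioo (ae_of_all _ fun t ht => ?_)).trans hwin)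
    have htI : t ∈ Ico 0 T := ⟨ha.trans ht.1.le, ht.2⟩
    have hC2 : ContDiff ℝ 2 (u t) := (hsol.contDiff_velocity htI).of_le (by norm_cast)
    have hL2 : ∫⁻ x, ‖u t x‖ₑ ^ 2 < ⊤ :=
      lt_of_le_of_lt (SereginSverak2002.eEnergy_le hν.le hLH ⟨htI.1, htI.2.le⟩) ENNReal.ofReal_lt_top
    exact lintegral_frobeniusNormSq_fderiv_le_lintegral_sq_norm_curl hC2 (hsol.divFree t htI) hL2
  -- combine in `ℝ`
  have hle : (σ.card : ℝ≥0∞) * ENNReal.ofReal (η * r) ≤ ENNReal.ofReal (2 * K' * r) := hlow.trans hup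
  rw [← ENNReal.ofReal_natCast, ← ENNReal.ofReal_mul (Nat.cast_nonneg _),
    ENNReal.ofReal_le_ofReal_iff (by positivity)] at hle
  have hreal : (σ.card : ℝ) ≤ 2 * K' / η := by
    rw [le_div_iff₀ hη]
    nlinarith [hle, hr]
  exact Nat.le_floor hreal

/-- **`QuarterLawTypeI ↔ UniformConcentrationCountTypeI`** (cruxes stmt-23726 and stmt-23970 of route
`TypeIQuarterGate` are equivalent): ⇒ by `count_of_quarterLaw` (`N = ⌊2K⁺/η⌋`, `r₀ = √T`), ⇐ by the
landed by-name stub `stub_countQuarterLaw` (sparse-core engine + one-scale ε-regularity smallness). An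
equivalence of OPEN statements; neither is asserted. [folklore] -/
theorem quarterLawTypeI_iff_uniformConcentrationCountTypeI :
    Summit.NavierStokesRegularity.NavierStokesRegularity.Theses.TypeIQuarterGate.QuarterLawTypeI ↔
      Summit.NavierStokesRegularity.NavierStokesRegularity.Theses.TypeIQuarterGate.UniformConcentrationCountTypeI := by
  unfold Summit.NavierStokesRegularity.NavierStokesRegularity.Theses.TypeIQuarterGate.QuarterLawTypeI
    Summit.NavierStokesRegularity.NavierStokesRegularity.Theses.TypeIQuarterGate.UniformConcentrationCountTypeI
  constructor
  · intro hK ν T hν hT u p hmax hLH hdec hI η hη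
    obtain ⟨K, hq⟩ := hK ν T hν hT u p hmax hLH hdec hI
    refine ⟨⌊2 * max K 0 / η⌋₊, Real.sqrt T, Real.sqrt_pos.2 hT, fun r hr hrT σ hsep hconc => ?_⟩
    exact count_of_quarterLaw hν hT hmax.1 hLH hq hη hr hrT σ hsep hconc
  · intro hC ν T hν hT u p hmax hLH hdec hI
    exact stub_countQuarterLaw ν T hν hT u p hmax hLH hdec hI (hC ν T hν hT u p hmax hLH hdec hI)

/-- **Crux reduction**: `UniformConcentrationCountTypeI → QuarterLawTypeI` (S1′ ⇒ K1; crux 23970 ⇒ crux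
23726 of route `TypeIQuarterGate`). An implication between OPEN statements. [folklore] -/
theorem quarterLawTypeI_of_uniformConcentrationCountTypeI
    (hC : Summit.NavierStokesRegularity.NavierStokesRegularity.Theses.TypeIQuarterGate.UniformConcentrationCountTypeI) :
    Summit.NavierStokesRegularity.NavierStokesRegularity.Theses.TypeIQuarterGate.QuarterLawTypeI :=
  quarterLawTypeI_iff_uniformConcentrationCountTypeI.2 hC

end CountQuarterLaw

end Summit.NavierStokesRegularity.NavierStokesRegularity.Theorems

end
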